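import Summits.QuantumFields.YangMills.Theorems.UnitScaleTiltProp7LatticeBoxFriedrichsCurved
import Literature.MathematicalPhysics.QuantumFieldTheory.Balaban1983to89.B9Thm31SitePolarisedFormY
import Literature.MathematicalPhysics.QuantumFieldTheory.Balaban1983to89.B9Thm311DeltaPrimePos
import HarnessLib

/-!
# Route `UnitScaleTilt`, crux K1 «MinimiserStabilityRegPr» (stmt-QuantumFields-19200) — route-R E′ (A′), (N06) row `hN06`, LANE II «DIVERGENCE RECOVERY AT CURVED W»
# (★★OWNER g29 RULING №23 (c): §4 box bricks → px4; skeleton §4 (B8) `boxLocalPotential`), part 1∕2 of (B8): **ALGEBRA OF THE LOCAL COULOMB POTENTIAL ON A BOX** — the real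
# Frobenius pairing `⟨A, B⟩ = Re tr(AᴴB)` on `M_N(ℂ)` (positivity, Young, unitary invariance, comparison with the operator norm), SUMMATION BY PARTS on the box graph for covariant
# differences, and the AXIAL CONSTANTS `x ↦ R(u x)⁻¹c` (their covariant gradient is `O(Rα)`; a box function pairing to zero with their orthogonal complement is one of them)

Cell `ym3-torus`, width seat `ym3-torus-px4` (gen 7).  THEOREMS ONLY (0 `def`, 0 `sorry`); `--supports stmt-QuantumFields-19200 --as helper`, count-neutral; consumer-independent.  YM₃ on T³
is a ladder rung (R3), not d = 4, not infinite volume, not the Clay problem; nothing here claims [Balaban1985BackgroundPropagators] Thm 3.3 ∕ 3.11, `hN06`, (REC), E′, EX, H, the crux or the gap.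

LETTERS: as (B1′)∕(B9) (`box z R ⊂ Zd d`, `unitVec`, background `V : Zd d → Fin d → (M_N(ℂ))ˣ` in lit `B7Prop2Explicit.unitaryUnits`, transport `R(u)X = uXu⁻¹` = lit `conjR`, covariant difference
`∇_Vφ (x,μ) = R(V x μ)φ(x+e_μ) − φ x`, covariant graph divergence `Σ_μ (R(V(x−e_μ) μ)⁻¹ r(x−e_μ) μ − r x μ)` of a one-form `r` living on the box edges, axial gauge `u = axialFn V (z−R)` (lit
`B7Prop1Explicit`)).  The pairing is written `(Matrix.trace (Aᴴ * B)).re` throughout (no definition).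

WHAT IS PROVED (ns `…Theorems.Prop7LatticeBoxPotentialAlgebra`): §1 the pairing (`trace_conjTranspose_mul_eq_sum`, `re_trace_self_eq_sum`, symmetry `re_trace_comm`; positivity and the
linearity rows are lit ✓`B9Thm311DeltaPrimePos.re_trace_conjTranspose_mul_self_nonneg` ∕ ✓`B9Thm31SitePolarisedFormY.re_trace_sub_left` … BY NAME), Young `two_mul_re_trace_le`, `opNorm_sq_le_re_trace_self`, `re_trace_self_le_mul_opNorm_sq`, ★`re_trace_conjR_conjR` (unitary invariance), `re_trace_conjR_left`); §2 ★★`sum_re_trace_grad_eq_sum_re_trace_div`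
(summation by parts on the box graph); §3 `grad_axialConst` + ★`re_trace_self_grad_axialConst_le` (`‖∇_V(R(u ·)⁻¹c)‖_F² ≤ (4dRα)²‖c‖_F²` on box bonds, from ✓`norm_axial_sub_one_le_of_plaqSmall`);
§4 ★`eq_axialConst_of_sum_re_trace_eq_zero` (a box function `κ` with `Σ_x ⟨ψ x, κ x⟩ = 0` for every `ψ` with `Σ_x R(u x)ψ x = 0` is `x ↦ R(u x)⁻¹m`, `m` = the axial mean).
§5 `covCurl_grad_eq` + ★`norm_covCurl_grad_le[_of_plaqSmall]` (`curl_V(∇_Vφ)` on a plaquette is `(R(P₁) − R(P₂))φ`, of size `≤ 2α‖φ‖` under the plaquette bound).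
HONEST SCOPE.  Linear algebra over landed letters; nothing of print asserted; rung R3, not Clay; YM gap NOT proved.
References: T. Bałaban, CMP **99** (1985) 389–434 [Balaban1985BackgroundPropagators] ((3.8)–(3.9) p.392, (3.23) p.394); CMP **98** (1985) 17–51 [Balaban1985Averaging] (pp.24–25, (56) p.27).
-/

set_option autoImplicit false
noncomputable section

open scoped BigOperators Matrix.Norms.L2Operator ComplexConjugate Matrix
open Finset

namespace Summit.QuantumFields.YangMills.Theorems.Prop7LatticeBoxPotentialAlgebra

open Literature.MathematicalPhysics.QuantumFieldTheory.Balaban1983to89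
open Literature.MathematicalPhysics.QuantumFieldTheory.Balaban1983to89.B4Eq19LatticeOperators
open B7Prop1Explicit (U1 gaugeAct axialFn)
open B7Prop2Explicit (unitaryUnits mem_unitaryUnits)
open B7Eq78Linearization (conjR conjR_apply conjR_sub conjR_add)
open B8Ineq132 (norm_conjR conjR_conjR one_conjR conjR_sum)
open B9Thm311DeltaPrimePos (re_trace_conjTranspose_mul_self_nonneg eq_zero_of_re_trace_conjTranspose_mul_self_eq_zero)
open B9Thm31SitePolarisedFormY (re_trace_ofReal_smul_left re_trace_ofReal_smul_right re_trace_sub_left re_trace_sub_right)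
open Summit.QuantumFields.YangMills.Theorems.Prop7CovariantCoercivity (opNorm_sq_le_sum_re_sq_add_im_sq sum_re_sq_add_im_sq_le_mul_opNorm_sq)

variable {N : ℕ}

/-! ## §1 The real Frobenius pairing `Re tr(AᴴB)` -/

section Pairing

/-- `tr(AᴴB) = Σ_{j,k} conj(A_jk)·B_jk`. [folklore] -/
theorem trace_conjTranspose_mul_eq_sum (A B : Matrix (Fin N) (Fin N) ℂ) :
    Matrix.trace (Aᴴ * B) = ∑ j : Fin N, ∑ k : Fin N, conj (A j k) * B j k := by
  rw [Matrix.trace, Finset.sum_comm]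
  refine Finset.sum_congr rfl fun k _ => ?_
  rw [Matrix.diag_apply, Matrix.mul_apply]
  refine Finset.sum_congr rfl fun j _ => ?_
  rw [Matrix.conjTranspose_apply, Complex.star_def]

/-- `Re tr(AᴴA) = Σ_{j,k} ((Re A_jk)² + (Im A_jk)²)`. [folklore] -/
theorem re_trace_self_eq_sum (A : Matrix (Fin N) (Fin N) ℂ) :
    (Matrix.trace (Aᴴ * A)).re = ∑ j : Fin N, ∑ k : Fin N, ((A j k).re ^ 2 + (A j k).im ^ 2) := by
  rw [trace_conjTranspose_mul_eq_sum, Complex.re_sum]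
  refine Finset.sum_congr rfl fun j _ => ?_
  rw [Complex.re_sum]
  refine Finset.sum_congr rfl fun k _ => ?_
  rw [Complex.mul_re, Complex.conj_re, Complex.conj_im]; ring

/-- Symmetry: `Re tr(AᴴB) = Re tr(BᴴA)`. [folklore] -/
theorem re_trace_comm (A B : Matrix (Fin N) (Fin N) ℂ) : (Matrix.trace (Aᴴ * B)).re = (Matrix.trace (Bᴴ * A)).re := by
  have : (Aᴴ * B) = (Bᴴ * A)ᴴ := by rw [Matrix.conjTranspose_mul, Matrix.conjTranspose_conjTranspose]
  rw [this, Matrix.trace_conjTranspose, Complex.star_def, Complex.conj_re]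

/-- Linearity rows of the pairing. [folklore] -/
theorem re_trace_add_left (A A' B : Matrix (Fin N) (Fin N) ℂ) :
    (Matrix.trace ((A + A')ᴴ * B)).re = (Matrix.trace (Aᴴ * B)).re + (Matrix.trace (A'ᴴ * B)).re := by
  rw [Matrix.conjTranspose_add, Matrix.add_mul, Matrix.trace_add, Complex.add_re]

/-- The expansion of `Re tr((tA − B)ᴴ(tA − B))`. [folklore] -/
theorem re_trace_self_sub_smul (t : ℝ) (A B : Matrix (Fin N) (Fin N) ℂ) :
    (Matrix.trace ((((t : ℂ) • A) - B)ᴴ * (((t : ℂ) • A) - B))).re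
      = t ^ 2 * (Matrix.trace (Aᴴ * A)).re - 2 * t * (Matrix.trace (Aᴴ * B)).re + (Matrix.trace (Bᴴ * B)).re := by
  rw [re_trace_sub_left, re_trace_sub_right, re_trace_sub_right, re_trace_ofReal_smul_left, re_trace_ofReal_smul_left, re_trace_comm B ((t : ℂ) • A),
    re_trace_ofReal_smul_left, re_trace_ofReal_smul_right]
  ring

/-- **YOUNG**: `2·Re tr(AᴴB) ≤ t·Re tr(AᴴA) + t⁻¹·Re tr(BᴴB)` for `t > 0`. [folklore] -/
theorem two_mul_re_trace_le {t : ℝ} (ht : 0 < t) (A B : Matrix (Fin N) (Fin N) ℂ) :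
    2 * (Matrix.trace (Aᴴ * B)).re ≤ t * (Matrix.trace (Aᴴ * A)).re + t⁻¹ * (Matrix.trace (Bᴴ * B)).re := by
  have h := re_trace_conjTranspose_mul_self_nonneg (((t : ℂ) • A) - B)
  rw [re_trace_self_sub_smul] at h
  have ht' : 0 < t⁻¹ := inv_pos.2 ht
  have key : 2 * (Matrix.trace (Aᴴ * B)).re ≤ t * (Matrix.trace (Aᴴ * A)).re + t⁻¹ * (Matrix.trace (Bᴴ * B)).re := by
    have := mul_le_mul_of_nonneg_left (show 0 ≤ t ^ 2 * (Matrix.trace (Aᴴ * A)).re - 2 * t * (Matrix.trace (Aᴴ * B)).re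
      + (Matrix.trace (Bᴴ * B)).re from h) ht'.le
    have e1 : t⁻¹ * (t ^ 2 * (Matrix.trace (Aᴴ * A)).re) = t * (Matrix.trace (Aᴴ * A)).re := by field_simp
    have e2 : t⁻¹ * (2 * t * (Matrix.trace (Aᴴ * B)).re) = 2 * (Matrix.trace (Aᴴ * B)).re := by field_simp
    nlinarith [e1, e2]
  exact key

/-- `‖A‖² ≤ Re tr(AᴴA)` (operator norm ≤ Hilbert–Schmidt norm). [folklore] -/
theorem opNorm_sq_le_re_trace_self (A : Matrix (Fin N) (Fin N) ℂ) : ‖A‖ ^ 2 ≤ (Matrix.trace (Aᴴ * A)).re := by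
  rw [re_trace_self_eq_sum]; exact opNorm_sq_le_sum_re_sq_add_im_sq A

/-- `Re tr(AᴴA) ≤ N·‖A‖²`. [folklore] -/
theorem re_trace_self_le_mul_opNorm_sq (A : Matrix (Fin N) (Fin N) ℂ) : (Matrix.trace (Aᴴ * A)).re ≤ N * ‖A‖ ^ 2 := by
  rw [re_trace_self_eq_sum]; exact sum_re_sq_add_im_sq_le_mul_opNorm_sq A

/-- A unitary unit of `M_N(ℂ)` lies in lit's `U1` (operator norm `1`). [cite: Balaban1985Averaging, (19) p.21] -/
theorem mem_U1_of_mem_unitaryUnits [NeZero N] {u : (Matrix (Fin N) (Fin N) ℂ)ˣ} (hu : u ∈ unitaryUnits (Matrix (Fin N) (Fin N) ℂ)) :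
    u ∈ U1 (Matrix (Fin N) (Fin N) ℂ) :=
  ⟨(CStarRing.norm_of_mem_unitary (mem_unitaryUnits.1 hu)).le,
   (CStarRing.norm_of_mem_unitary (mem_unitaryUnits.1 ((unitaryUnits _).inv_mem hu))).le⟩

/-- For `u ∈ unitaryUnits`, `u⁻¹ = uᴴ` as matrices. [folklore] -/
theorem val_inv_eq_conjTranspose {u : (Matrix (Fin N) (Fin N) ℂ)ˣ} (hu : u ∈ unitaryUnits (Matrix (Fin N) (Fin N) ℂ)) :
    ((u⁻¹ : (Matrix (Fin N) (Fin N) ℂ)ˣ) : Matrix (Fin N) (Fin N) ℂ) = (u : Matrix (Fin N) (Fin N) ℂ)ᴴ := by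
  rw [mem_unitaryUnits] at hu
  have h : ((u⁻¹ : (Matrix (Fin N) (Fin N) ℂ)ˣ) : Matrix (Fin N) (Fin N) ℂ) * (u : Matrix (Fin N) (Fin N) ℂ) = 1 := Units.inv_mul u
  have h' : (u : Matrix (Fin N) (Fin N) ℂ)ᴴ * (u : Matrix (Fin N) (Fin N) ℂ) = 1 := Unitary.star_mul_self_of_mem hu
  calc ((u⁻¹ : (Matrix (Fin N) (Fin N) ℂ)ˣ) : Matrix (Fin N) (Fin N) ℂ)
      = ((u⁻¹ : (Matrix (Fin N) (Fin N) ℂ)ˣ) : Matrix (Fin N) (Fin N) ℂ) * ((u : Matrix (Fin N) (Fin N) ℂ) * ((u⁻¹ : (Matrix (Fin N) (Fin N) ℂ)ˣ) : Matrix (Fin N) (Fin N) ℂ)) := by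
        rw [Units.mul_inv, mul_one]
    _ = (u : Matrix (Fin N) (Fin N) ℂ)ᴴ * (u : Matrix (Fin N) (Fin N) ℂ) * ((u⁻¹ : (Matrix (Fin N) (Fin N) ℂ)ˣ) : Matrix (Fin N) (Fin N) ℂ) * 1 := by
        rw [h', one_mul, mul_one, ← mul_assoc, h, one_mul]
    _ = (u : Matrix (Fin N) (Fin N) ℂ)ᴴ := by rw [mul_one, mul_assoc, Units.mul_inv, mul_one]

/-- ★ **UNITARY INVARIANCE**: `Re tr((R(u)A)ᴴ(R(u)B)) = Re tr(AᴴB)` for `u ∈ unitaryUnits` (indeed the traces agree). [cite: Balaban1985BackgroundPropagators, (3.23) p.394] -/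
theorem trace_conjR_conjR {u : (Matrix (Fin N) (Fin N) ℂ)ˣ} (hu : u ∈ unitaryUnits (Matrix (Fin N) (Fin N) ℂ)) (A B : Matrix (Fin N) (Fin N) ℂ) :
    Matrix.trace ((conjR u A)ᴴ * conjR u B) = Matrix.trace (Aᴴ * B) := by
  have hinv := val_inv_eq_conjTranspose hu
  have hU : (u : Matrix (Fin N) (Fin N) ℂ)ᴴ * (u : Matrix (Fin N) (Fin N) ℂ) = 1 := Unitary.star_mul_self_of_mem (mem_unitaryUnits.1 hu)
  rw [conjR_apply, conjR_apply, hinv, Matrix.conjTranspose_mul, Matrix.conjTranspose_mul, Matrix.conjTranspose_conjTranspose]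
  -- `(u Aᴴ uᴴ)(u B uᴴ) = u Aᴴ B uᴴ`, trace cyclic
  have e : (u : Matrix (Fin N) (Fin N) ℂ) * (Aᴴ * (u : Matrix (Fin N) (Fin N) ℂ)ᴴ) * ((u : Matrix (Fin N) (Fin N) ℂ) * B * (u : Matrix (Fin N) (Fin N) ℂ)ᴴ)
      = (u : Matrix (Fin N) (Fin N) ℂ) * (Aᴴ * B) * (u : Matrix (Fin N) (Fin N) ℂ)ᴴ := by
    calc _ = (u : Matrix (Fin N) (Fin N) ℂ) * Aᴴ * ((u : Matrix (Fin N) (Fin N) ℂ)ᴴ * (u : Matrix (Fin N) (Fin N) ℂ)) * B * (u : Matrix (Fin N) (Fin N) ℂ)ᴴ := by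
          simp only [Matrix.mul_assoc]
      _ = _ := by rw [hU, Matrix.mul_one, Matrix.mul_assoc (u : Matrix (Fin N) (Fin N) ℂ)]
  rw [e, Matrix.trace_mul_cycle, hU, Matrix.one_mul]

/-- Unitary invariance of the real pairing. [cite: Balaban1985BackgroundPropagators, (3.23) p.394] -/
theorem re_trace_conjR_conjR {u : (Matrix (Fin N) (Fin N) ℂ)ˣ} (hu : u ∈ unitaryUnits (Matrix (Fin N) (Fin N) ℂ)) (A B : Matrix (Fin N) (Fin N) ℂ) :
    (Matrix.trace ((conjR u A)ᴴ * conjR u B)).re = (Matrix.trace (Aᴴ * B)).re := by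
  rw [trace_conjR_conjR hu]

/-- Moving a transport across the pairing: `Re tr((R(u)A)ᴴB) = Re tr(Aᴴ(R(u)⁻¹B))`. [cite: Balaban1985BackgroundPropagators, (3.8) p.392] -/
theorem re_trace_conjR_left {u : (Matrix (Fin N) (Fin N) ℂ)ˣ} (hu : u ∈ unitaryUnits (Matrix (Fin N) (Fin N) ℂ)) (A B : Matrix (Fin N) (Fin N) ℂ) :
    (Matrix.trace ((conjR u A)ᴴ * B)).re = (Matrix.trace (Aᴴ * conjR u⁻¹ B)).re := by
  have h := re_trace_conjR_conjR ((unitaryUnits _).inv_mem hu) (conjR u A) B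
  rw [conjR_conjR, inv_mul_cancel, one_conjR] at h
  exact h.symm

end Pairing

/-! ## §2 Summation by parts on the box graph -/

section ByParts

variable {d : ℕ}

/-- Two boxes containing the support of `H` give the same sum. [folklore] -/
theorem sum_box_eq_sum_box_of_support {z z' : Zd d} {R R' : ℤ} {H : Zd d → ℝ}
    (h1 : ∀ y ∉ box z R, H y = 0) (h2 : ∀ y ∉ box z' R', H y = 0) :
    ∑ y ∈ box z R, H y = ∑ y ∈ box z' R', H y := by
  classical
  have e1 : ∑ y ∈ box z R ∩ box z' R', H y = ∑ y ∈ box z R, H y :=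
    Finset.sum_subset Finset.inter_subset_left fun y hy hyn => h2 y fun h => hyn (Finset.mem_inter.2 ⟨hy, h⟩)
  have e2 : ∑ y ∈ box z R ∩ box z' R', H y = ∑ y ∈ box z' R', H y :=
    Finset.sum_subset Finset.inter_subset_right fun y hy hyn => h1 y fun h => hyn (Finset.mem_inter.2 ⟨h, hy⟩)
  rw [← e1, e2]

/-- Shift of a box sum for a function supported in the box and in its translate. [folklore] -/
theorem sum_box_shift_eq {z : Zd d} {R : ℤ} {H : Zd d → ℝ} (v : Zd d)
    (h1 : ∀ y ∉ box z R, H y = 0) (h2 : ∀ y, y - v ∉ box z R → H y = 0) :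
    ∑ y ∈ box z R, H (y + v) = ∑ y ∈ box z R, H y := by
  rw [sum_box_add_right H z v R]
  refine sum_box_eq_sum_box_of_support (fun y hy => h2 y fun h => hy ?_) h1
  -- `y - v ∈ box z R ⟹ y ∈ box (z + v) R`
  rw [mem_box] at h ⊢
  intro i; have := h i; simp only [Pi.sub_apply, Pi.add_apply] at this ⊢
  have e : y i - (z i + v i) = y i - v i - z i := by ring
  rw [e]; exact this

/-- ★★ **SUMMATION BY PARTS ON THE BOX GRAPH**: for a one-form `r` living on the edges of `Q_R(z)`, a unitary background `V` and any site function `ψ`,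
`Σ_{Q_R}Σ_μ Re tr((R(V y μ)ψ(y+e_μ) − ψ y)ᴴ r y μ) = Σ_{Q_R} Re tr((ψ y)ᴴ · Σ_μ (R(V(y−e_μ) μ)⁻¹ r(y−e_μ) μ − r y μ))` — the covariant gradient and the covariant graph
divergence are adjoint. [cite: Balaban1985BackgroundPropagators, (3.8) p.392] -/
theorem sum_re_trace_grad_eq_sum_re_trace_div {z : Zd d} {R : ℤ}
    (V : Zd d → Fin d → (Matrix (Fin N) (Fin N) ℂ)ˣ) (hV : ∀ y μ, V y μ ∈ unitaryUnits (Matrix (Fin N) (Fin N) ℂ))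
    (r : Zd d → Fin d → Matrix (Fin N) (Fin N) ℂ) (hr : ∀ (y : Zd d) (μ : Fin d), (y ∉ box z R ∨ y + unitVec μ ∉ box z R) → r y μ = 0)
    (ψ : Zd d → Matrix (Fin N) (Fin N) ℂ) :
    ∑ y ∈ box z R, ∑ μ, (Matrix.trace ((conjR (V y μ) (ψ (y + unitVec μ)) - ψ y)ᴴ * r y μ)).re
      = ∑ y ∈ box z R, (Matrix.trace ((ψ y)ᴴ * ∑ μ, (conjR (V (y - unitVec μ) μ)⁻¹ (r (y - unitVec μ) μ) - r y μ))).re := by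
  -- expand both sides
  have eL : ∀ (y : Zd d) (μ : Fin d), (Matrix.trace ((conjR (V y μ) (ψ (y + unitVec μ)) - ψ y)ᴴ * r y μ)).re
      = (Matrix.trace ((ψ (y + unitVec μ))ᴴ * conjR (V y μ)⁻¹ (r y μ))).re - (Matrix.trace ((ψ y)ᴴ * r y μ)).re := by
    intro y μ; rw [re_trace_sub_left, re_trace_conjR_left (hV y μ)]
  have eR : ∀ y : Zd d, (Matrix.trace ((ψ y)ᴴ * ∑ μ, (conjR (V (y - unitVec μ) μ)⁻¹ (r (y - unitVec μ) μ) - r y μ))).re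
      = ∑ μ, ((Matrix.trace ((ψ y)ᴴ * conjR (V (y - unitVec μ) μ)⁻¹ (r (y - unitVec μ) μ))).re - (Matrix.trace ((ψ y)ᴴ * r y μ)).re) := by
    intro y
    rw [Matrix.mul_sum, Matrix.trace_sum, Complex.re_sum]
    exact Finset.sum_congr rfl fun μ _ => re_trace_sub_right _ _ _
  rw [Finset.sum_congr rfl (fun y _ => eR y)]
  simp only [eL, Finset.sum_sub_distrib]
  congr 1
  -- the shifted term: `Σ_{y∈Q} G_μ(y + e_μ) = Σ_{y∈Q} G_μ(y)`
  rw [Finset.sum_comm]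
  conv_rhs => rw [Finset.sum_comm]
  refine Finset.sum_congr rfl fun μ _ => ?_
  have h := sum_box_shift_eq (z := z) (R := R)
    (H := fun w => (Matrix.trace ((ψ w)ᴴ * conjR (V (w - unitVec μ) μ)⁻¹ (r (w - unitVec μ) μ))).re) (unitVec μ)
    (fun w hw => by
      have : r (w - unitVec μ) μ = 0 := hr _ _ (Or.inr (by rwa [sub_add_cancel]))
      simp only [this, conjR_apply, mul_zero, zero_mul, Matrix.trace_zero, Complex.zero_re])
    (fun w hw => by
      have : r (w - unitVec μ) μ = 0 := hr _ _ (Or.inl hw)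
      simp only [this, conjR_apply, mul_zero, zero_mul, Matrix.trace_zero, Complex.zero_re])
  simp only [add_sub_cancel_right] at h
  exact h

end ByParts

/-! ## §3 The axial constants `x ↦ R(u x)⁻¹ c` and their covariant gradient -/

section AxialConst

variable {d : ℕ}

/-- The covariant gradient of an axial constant: `R(V x μ)(R(u(x+e_μ))⁻¹c) − R(u x)⁻¹c = R(u x)⁻¹(R(V₀ x μ)c − c)`, `V₀ = gaugeAct u V`. [cite: Balaban1985Averaging, (9) p.19] -/
theorem grad_axialConst (u : Zd d → (Matrix (Fin N) (Fin N) ℂ)ˣ) (V : Zd d → Fin d → (Matrix (Fin N) (Fin N) ℂ)ˣ) (c : Matrix (Fin N) (Fin N) ℂ)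
    (x : Zd d) (μ : Fin d) :
    conjR (V x μ) (conjR (u (x + unitVec μ))⁻¹ c) - conjR (u x)⁻¹ c = conjR (u x)⁻¹ (conjR (gaugeAct u V x μ) c - c) := by
  rw [conjR_sub, conjR_conjR, conjR_conjR, gaugeAct, Prop7LatticeBoxFriedrichsCurved.unitVec_eq_e]
  congr 1
  rw [← mul_assoc, ← mul_assoc, inv_mul_cancel, one_mul]

/-- ★ **THE COVARIANT GRADIENT OF AN AXIAL CONSTANT IS `O(Rα)`**: with `u := axialFn V (z−R)` and `PlaqSmall V (z−R) (z+R) α`, on every bond of `Q_R(z)`,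
`Re tr((∇_V(R(u ·)⁻¹c)(x,μ))ᴴ(∇_V(R(u ·)⁻¹c)(x,μ))) ≤ N·(4dRα)²·Re tr(cᴴc)`. [cite: Balaban1985Averaging, pp.24-25] -/
theorem re_trace_self_grad_axialConst_le [NeZero N] {z : Zd d} {R : ℤ} {α : ℝ} (hα : 0 ≤ α)
    (V : Zd d → Fin d → (Matrix (Fin N) (Fin N) ℂ)ˣ) (hV : ∀ y μ, V y μ ∈ unitaryUnits (Matrix (Fin N) (Fin N) ℂ))
    (hP : B8Lemma1NonAbelian.PlaqSmall V (fun i => z i - R) (fun i => z i + R) α)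
    (c : Matrix (Fin N) (Fin N) ℂ) (x : Zd d) (μ : Fin d) (hx : x ∈ box z R) (hxμ : x + unitVec μ ∈ box z R) :
    (Matrix.trace ((conjR (V x μ) (conjR (axialFn V (fun i => z i - R) (x + unitVec μ))⁻¹ c) - conjR (axialFn V (fun i => z i - R) x)⁻¹ c)ᴴ
        * (conjR (V x μ) (conjR (axialFn V (fun i => z i - R) (x + unitVec μ))⁻¹ c) - conjR (axialFn V (fun i => z i - R) x)⁻¹ c))).re
      ≤ N * (4 * d * R * α) ^ 2 * (Matrix.trace (cᴴ * c)).re := by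
  have hV1 : ∀ y μ, V y μ ∈ U1 (Matrix (Fin N) (Fin N) ℂ) := fun y μ => mem_U1_of_mem_unitaryUnits (hV y μ)
  set u := axialFn V (fun i => z i - R) with hu
  have hum : ∀ y, u y ∈ unitaryUnits (Matrix (Fin N) (Fin N) ℂ) := fun y => B7Prop2Explicit.hol_mem_of hV _ _
  rw [grad_axialConst u V c x μ, re_trace_conjR_conjR ((unitaryUnits _).inv_mem (hum x))]
  -- `‖R(V₀)c − c‖ ≤ 2‖V₀ − 1‖‖c‖ ≤ 2·2dRα‖c‖`
  have hb := Prop7LatticeBoxFriedrichsCurved.norm_axial_sub_one_le_of_plaqSmall hα V hV1 hP x μ hx hxμ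
  have h1 : ‖conjR (gaugeAct u V x μ) c - c‖ ≤ 2 * (2 * d * R * α) * ‖c‖ := by
    have := Prop7LatticeBoxFriedrichsCov.norm_conjR_sub_self_le (B7Prop1Explicit.gaugeAct_mem hV1 (fun y => mem_U1_of_mem_unitaryUnits (hum y)) x μ) c
    have hc : 0 ≤ ‖c‖ := norm_nonneg c
    nlinarith
  calc (Matrix.trace ((conjR (gaugeAct u V x μ) c - c)ᴴ * (conjR (gaugeAct u V x μ) c - c))).re
      ≤ N * ‖conjR (gaugeAct u V x μ) c - c‖ ^ 2 := re_trace_self_le_mul_opNorm_sq _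
    _ ≤ N * (2 * (2 * d * R * α) * ‖c‖) ^ 2 := by
        have := pow_le_pow_left₀ (norm_nonneg _) h1 2
        exact mul_le_mul_of_nonneg_left this (Nat.cast_nonneg _)
    _ = N * (4 * d * R * α) ^ 2 * ‖c‖ ^ 2 := by ring
    _ ≤ N * (4 * d * R * α) ^ 2 * (Matrix.trace (cᴴ * c)).re :=
        mul_le_mul_of_nonneg_left (opNorm_sq_le_re_trace_self c) (by positivity)

end AxialConst

/-! ## §4 A box function pairing to zero with the complement of the axial constants is an axial constant -/

section Dual

variable {d : ℕ}

/-- `R(u)(R(u)⁻¹ m) = m`. [folklore] -/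
theorem conjR_conjR_inv (u : (Matrix (Fin N) (Fin N) ℂ)ˣ) (m : Matrix (Fin N) (Fin N) ℂ) : conjR u (conjR u⁻¹ m) = m := by
  rw [conjR_conjR, mul_inv_cancel, one_conjR]

/-- ★ **DUALITY**: let `u` be unitary-valued, `κ` a box function, and `m := |Q_R|⁻¹·Σ_{Q_R} R(u x)(κ x)` its axial mean.  If `Σ_{Q_R} Re tr((ψ x)ᴴ κ x) = 0` for EVERY `ψ` with
`Σ_{Q_R} R(u x)(ψ x) = 0`, then `κ x = R(u x)⁻¹ m` on `Q_R(z)`. [folklore] -/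
theorem eq_axialConst_of_sum_re_trace_eq_zero {z : Zd d} {R : ℤ} (hR : 0 ≤ R)
    (u : Zd d → (Matrix (Fin N) (Fin N) ℂ)ˣ) (hu : ∀ x, u x ∈ unitaryUnits (Matrix (Fin N) (Fin N) ℂ))
    (κ : Zd d → Matrix (Fin N) (Fin N) ℂ)
    (hκ : ∀ ψ : Zd d → Matrix (Fin N) (Fin N) ℂ, ∑ x ∈ box z R, conjR (u x) (ψ x) = 0 → ∑ x ∈ box z R, (Matrix.trace ((ψ x)ᴴ * κ x)).re = 0) :
    ∀ x ∈ box z R, κ x = conjR (u x)⁻¹ ((((box z R).card : ℝ) : ℂ)⁻¹ • ∑ x' ∈ box z R, conjR (u x') (κ x')) := by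
  classical
  set m : Matrix (Fin N) (Fin N) ℂ := (((box z R).card : ℝ) : ℂ)⁻¹ • ∑ x' ∈ box z R, conjR (u x') (κ x') with hm
  set ψ : Zd d → Matrix (Fin N) (Fin N) ℂ := fun x => κ x - conjR (u x)⁻¹ m with hψ
  -- the box is nonempty
  have hcard : ((box z R).card : ℝ) ≠ 0 := by
    have : (box z R).Nonempty := ⟨z, self_mem_box z hR⟩
    exact_mod_cast this.card_pos.ne'
  -- `ψ` is admissible: `Σ R(u)ψ = S − card•m = 0`
  have hψ0 : ∑ x ∈ box z R, conjR (u x) (ψ x) = 0 := by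
    have e1 : ∀ x, conjR (u x) (ψ x) = conjR (u x) (κ x) - m := fun x => by rw [hψ, conjR_sub, conjR_conjR_inv]
    simp only [e1, Finset.sum_sub_distrib, Finset.sum_const, hm]
    rw [← Nat.cast_smul_eq_nsmul ℂ, smul_smul, ← Complex.ofReal_natCast, ← Complex.ofReal_inv, ← Complex.ofReal_mul,
      mul_inv_cancel₀ hcard, Complex.ofReal_one, one_smul, sub_self]
  have h0 := hκ ψ hψ0
  -- split `κ = ψ + R(u)⁻¹m` in the pairing
  have e2 : ∀ x, (Matrix.trace ((ψ x)ᴴ * κ x)).re = (Matrix.trace ((ψ x)ᴴ * ψ x)).re + (Matrix.trace ((conjR (u x) (ψ x))ᴴ * m)).re := by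
    intro x
    have hk : κ x = ψ x + conjR (u x)⁻¹ m := by
      show κ x = (κ x - conjR (u x)⁻¹ m) + conjR (u x)⁻¹ m
      rw [sub_add_cancel]
    conv_lhs => rw [hk]
    rw [Matrix.mul_add, Matrix.trace_add, Complex.add_re, re_trace_conjR_left (hu x)]
  have e3 : ∑ x ∈ box z R, (Matrix.trace ((conjR (u x) (ψ x))ᴴ * m)).re = 0 := by
    rw [← Complex.re_sum, ← Matrix.trace_sum, ← Finset.sum_mul, ← Matrix.conjTranspose_sum, hψ0]
    simp
  rw [Finset.sum_congr rfl (fun x _ => e2 x), Finset.sum_add_distrib, e3, add_zero] at h0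
  -- a vanishing sum of nonnegative terms
  have hall := (Finset.sum_eq_zero_iff_of_nonneg (fun x _ => re_trace_conjTranspose_mul_self_nonneg (ψ x))).1 h0
  intro x hx
  have hψx : ψ x = 0 := eq_zero_of_re_trace_conjTranspose_mul_self_eq_zero (hall x hx)
  have : κ x - conjR (u x)⁻¹ m = 0 := hψx
  exact sub_eq_zero.1 this

end Dual

/-! ## §5 The curl of a covariant gradient is a plaquette defect -/

section CurlGrad

variable {d : ℕ}

/-- ★ **`curl_V(∇_Vφ)` IS A HOLONOMY DEFECT**: on the plaquette `(y, μ, ν)`,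
`∇φ(y,μ) + R(V y μ)∇φ(y+e_μ,ν) − R(V y ν)∇φ(y+e_ν,μ) − ∇φ(y,ν) = R(V y μ·V(y+e_μ) ν)φ(y+e_μ+e_ν) − R(V y ν·V(y+e_ν) μ)φ(y+e_μ+e_ν)`.
[cite: Balaban1985BackgroundPropagators, (3.10) p.392] -/
theorem covCurl_grad_eq (V : Zd d → Fin d → (Matrix (Fin N) (Fin N) ℂ)ˣ) (φ : Zd d → Matrix (Fin N) (Fin N) ℂ) (y : Zd d) (μ ν : Fin d) :
    (conjR (V y μ) (φ (y + unitVec μ)) - φ y)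
        + conjR (V y μ) (conjR (V (y + unitVec μ) ν) (φ (y + unitVec μ + unitVec ν)) - φ (y + unitVec μ))
        - conjR (V y ν) (conjR (V (y + unitVec ν) μ) (φ (y + unitVec ν + unitVec μ)) - φ (y + unitVec ν))
        - (conjR (V y ν) (φ (y + unitVec ν)) - φ y)
      = conjR (V y μ * V (y + unitVec μ) ν) (φ (y + unitVec μ + unitVec ν))
        - conjR (V y ν * V (y + unitVec ν) μ) (φ (y + unitVec μ + unitVec ν)) := by
  rw [add_right_comm y (unitVec ν) (unitVec μ), conjR_sub, conjR_sub, conjR_conjR, conjR_conjR]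
  abel

/-- ★ **SIZE OF `curl_V(∇_Vφ)`**: if the plaquette holonomy satisfies `‖V y μ·V(y+e_μ) ν·(V(y+e_ν) μ)⁻¹·(V y ν)⁻¹ − 1‖ ≤ α` (`V` in `U1`), then
`‖curl_V(∇_Vφ)(y,μ,ν)‖ ≤ 2α·‖φ(y+e_μ+e_ν)‖`. [cite: Balaban1985BackgroundPropagators, (3.10) p.392] -/
theorem norm_covCurl_grad_le [NeZero N] (V : Zd d → Fin d → (Matrix (Fin N) (Fin N) ℂ)ˣ) (hV : ∀ y μ, V y μ ∈ U1 (Matrix (Fin N) (Fin N) ℂ))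
    {α : ℝ} (y : Zd d) (μ ν : Fin d)
    (hpl : ‖((V y μ * V (y + unitVec μ) ν * (V (y + unitVec ν) μ)⁻¹ * (V y ν)⁻¹ : (Matrix (Fin N) (Fin N) ℂ)ˣ) : Matrix (Fin N) (Fin N) ℂ) - 1‖ ≤ α)
    (φ : Zd d → Matrix (Fin N) (Fin N) ℂ) :
    ‖(conjR (V y μ) (φ (y + unitVec μ)) - φ y)
        + conjR (V y μ) (conjR (V (y + unitVec μ) ν) (φ (y + unitVec μ + unitVec ν)) - φ (y + unitVec μ))
        - conjR (V y ν) (conjR (V (y + unitVec ν) μ) (φ (y + unitVec ν + unitVec μ)) - φ (y + unitVec ν))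
        - (conjR (V y ν) (φ (y + unitVec ν)) - φ y)‖
      ≤ 2 * α * ‖φ (y + unitVec μ + unitVec ν)‖ := by
  rw [covCurl_grad_eq]
  set P₁ : (Matrix (Fin N) (Fin N) ℂ)ˣ := V y μ * V (y + unitVec μ) ν with hP₁
  set P₂ : (Matrix (Fin N) (Fin N) ℂ)ˣ := V y ν * V (y + unitVec ν) μ with hP₂
  set X := φ (y + unitVec μ + unitVec ν)
  have hP₂U : P₂ ∈ U1 (Matrix (Fin N) (Fin N) ℂ) := (U1 _).mul_mem (hV _ _) (hV _ _)
  have hHU : P₁ * P₂⁻¹ ∈ U1 (Matrix (Fin N) (Fin N) ℂ) :=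
    (U1 _).mul_mem ((U1 _).mul_mem (hV _ _) (hV _ _)) ((U1 _).inv_mem hP₂U)
  have hH : P₁ * P₂⁻¹ = V y μ * V (y + unitVec μ) ν * (V (y + unitVec ν) μ)⁻¹ * (V y ν)⁻¹ := by
    rw [hP₁, hP₂, mul_inv_rev, ← mul_assoc]
  have e : conjR P₁ X = conjR (P₁ * P₂⁻¹) (conjR P₂ X) := by rw [conjR_conjR, inv_mul_cancel_right]
  rw [e]
  calc ‖conjR (P₁ * P₂⁻¹) (conjR P₂ X) - conjR P₂ X‖
      ≤ 2 * ‖((P₁ * P₂⁻¹ : (Matrix (Fin N) (Fin N) ℂ)ˣ) : Matrix (Fin N) (Fin N) ℂ) - 1‖ * ‖conjR P₂ X‖ :=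
        Prop7LatticeBoxFriedrichsCov.norm_conjR_sub_self_le hHU _
    _ = 2 * ‖((P₁ * P₂⁻¹ : (Matrix (Fin N) (Fin N) ℂ)ˣ) : Matrix (Fin N) (Fin N) ℂ) - 1‖ * ‖X‖ := by rw [norm_conjR hP₂U]
    _ ≤ 2 * α * ‖X‖ := by
        rw [hH]
        exact mul_le_mul_of_nonneg_right (mul_le_mul_of_nonneg_left hpl (by norm_num)) (norm_nonneg _)

/-- ★ The same inside the box `Q_R(z)` under `PlaqSmall V (z−R) (z+R) α` (all `μ, ν`; for `μ = ν` the curl vanishes).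
[cite: Balaban1985BackgroundPropagators, (3.10) p.392; Balaban1985Averaging, pp.24-25] -/
theorem norm_covCurl_grad_le_of_plaqSmall [NeZero N] {z : Zd d} {R : ℤ} {α : ℝ} (hα : 0 ≤ α)
    (V : Zd d → Fin d → (Matrix (Fin N) (Fin N) ℂ)ˣ) (hV : ∀ y μ, V y μ ∈ U1 (Matrix (Fin N) (Fin N) ℂ))
    (hP : B8Lemma1NonAbelian.PlaqSmall V (fun i => z i - R) (fun i => z i + R) α)
    (φ : Zd d → Matrix (Fin N) (Fin N) ℂ) (y : Zd d) (μ ν : Fin d) (hy : y ∈ box z R) (hyμν : y + unitVec μ + unitVec ν ∈ box z R) :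
    ‖(conjR (V y μ) (φ (y + unitVec μ)) - φ y)
        + conjR (V y μ) (conjR (V (y + unitVec μ) ν) (φ (y + unitVec μ + unitVec ν)) - φ (y + unitVec μ))
        - conjR (V y ν) (conjR (V (y + unitVec ν) μ) (φ (y + unitVec ν + unitVec μ)) - φ (y + unitVec ν))
        - (conjR (V y ν) (φ (y + unitVec ν)) - φ y)‖
      ≤ 2 * α * ‖φ (y + unitVec μ + unitVec ν)‖ := by
  by_cases hμν : μ = ν
  · subst hμν
    have h0 : (conjR (V y μ) (φ (y + unitVec μ)) - φ y)
        + conjR (V y μ) (conjR (V (y + unitVec μ) μ) (φ (y + unitVec μ + unitVec μ)) - φ (y + unitVec μ))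
        - conjR (V y μ) (conjR (V (y + unitVec μ) μ) (φ (y + unitVec μ + unitVec μ)) - φ (y + unitVec μ))
        - (conjR (V y μ) (φ (y + unitVec μ)) - φ y) = 0 := by abel
    rw [h0, norm_zero]; positivity
  · refine norm_covCurl_grad_le V hV y μ ν ?_ φ
    have h := hP y μ ν hμν ((Prop7LatticeBoxFriedrichsCurved.mem_box_iff_le z y R).1 hy).1
      (by
        have := ((Prop7LatticeBoxFriedrichsCurved.mem_box_iff_le z _ R).1 hyμν).2
        rwa [Prop7LatticeBoxFriedrichsCurved.unitVec_eq_e, Prop7LatticeBoxFriedrichsCurved.unitVec_eq_e] at this)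
    rwa [B7Prop1Local.hol_plaqWord_eq] at h

end CurlGrad

end Summit.QuantumFields.YangMills.Theorems.Prop7LatticeBoxPotentialAlgebra

end
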